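import Summits.RiemannHypothesis.RiemannHypothesis.Theorems.TiltedLandingLaw421MonovariantSocketB
import Mathlib.Analysis.Calculus.Deriv.Star

/-! # TiltedLandingLaw421MonovariantTentInit
c13 TENT meter (C4 seal l.5159): `stripCount`, `tentCount`, `razor`, `tentAt`, `tentMeterMax`, Schwarz reflection `conj_zero_of_real_entire`, pair bookkeeping `tentCount_add_two_le_stripCount`, `AnchorSig`, INIT on the anchor class `monovariantInit_tentMeterMax_of_anchor` (anchor explicit as hypothesis, gate c4).
SUPPORT module for crux `TiltedLandingLaw421` (stmt-RiemannHypothesis-24774), `--supports` only: proves no stub, no crux; fully proved (no `sorry`).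
Packaged by C4 rh-idea-6 g21 per director (CA239)(1) in the (CA237) lint shape. RH is not proved. -/

namespace RhIdea6.G20.W07C13pre.Tent

open Complex
open RhIdea6.G17.W07C7 RhIdea6.G17.W07C7.Rev6 RhIdea6.G18.W07C8.Law421BirthS RhIdea6.G19.W07C11.Seam
open RhIdea6.G20.W07C12.Frac RhIdea6.G20.W07C12.StColP RhW07.C12.FieldSplit

/-- zeros of `g` with multiplicity in the vertical strip `|Re z − c| ≤ r` (the `ColumnBudgetMult` summand, centre free). -/
noncomputable def stripCount (g : ℂ → ℂ) (c r : ℝ) : ℝ :=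
  ∑ᶠ z ∈ {z : ℂ | g z = 0 ∧ |z.re - c| ≤ r}, ((analyticOrderAt g z).toNat : ℝ)

/-- companions: the strip count about centre `c`, radius `r`, EXCLUDING the pair `{u, conj u}`. -/
noncomputable def tentCount (g : ℂ → ℂ) (c r : ℝ) (u : ℂ) : ℝ :=
  ∑ᶠ z ∈ {z : ℂ | g z = 0 ∧ |z.re - c| ≤ r ∧ z ≠ u ∧ z ≠ (starRingEnd ℂ) u}, ((analyticOrderAt g z).toNat : ℝ)

/-- the companion count is non-negative. -/
theorem tentCount_nonneg (g : ℂ → ℂ) (c r : ℝ) (u : ℂ) : 0 ≤ tentCount g c r u :=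
  finsum_nonneg fun _ => finsum_nonneg fun _ => Nat.cast_nonneg _

/-- the razor (ρ² ≤ 3): `2ρh − 2 ≤ h² + 1`. -/
theorem razor {ρ h : ℝ} (hρ : ρ ^ 2 ≤ 3) : 2 * ρ * h - 2 ≤ h ^ 2 + 1 := by
  nlinarith [sq_nonneg (h - ρ)]

end RhIdea6.G20.W07C13pre.Tent

namespace RhIdea6.G21.W07C13.TentMax

open Complex Filter Topology
open RhIdea6.G17.W07C7 RhIdea6.G17.W07C7.Rev6 RhIdea6.G18.W07C8.Law421BirthS RhIdea6.G19.W07C11.Seam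
open RhIdea6.G20.W07C12.Frac RhIdea6.G20.W07C12.StColP RhW07.C12.FieldSplit RhIdea6.G20.W07C13pre.Tent

/-- the lineage tent READING at state `u` of level `j`: companions of `u` (pair excluded) within `|Re z − Re u| ≤ ρ·Im u`. -/
noncomputable def tentAt (ρ : ℝ) (f : ℂ → ℂ) (j : ℕ) (u : ℂ) : ℝ :=
  tentCount (iteratedDeriv j f) u.re (ρ * u.im) u

/-- **T^max_j(ρ)** — the SEALED meter: MAX of the tent readings over the lowest `StCol'` states of level `j` (`sSup`, `= 0` on an empty level). -/
noncomputable def tentMeterMax (ρ : ℝ) : LevelMeter := fun η f x₀ s hmax R Hs B j =>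
  sSup (tentAt ρ f j '' {u : ℂ | IsLowest StCol' η f x₀ s hmax R Hs B j u})

/-- `tentAt_nonneg` (W-07 c13 §U; token-identical to C4 sectionU.part 45275a1c). -/
theorem tentAt_nonneg (ρ : ℝ) (f : ℂ → ℂ) (j : ℕ) (u : ℂ) : 0 ≤ tentAt ρ f j u := tentCount_nonneg _ _ _ _

/-- (K) the sealed meter is non-negative (clause (ii) of the prefix socket, unconditionally). -/
theorem tentMeterMax_nonneg (ρ η : ℝ) (f : ℂ → ℂ) (x₀ s hmax R Hs : ℝ) (B j : ℕ) : 0 ≤ tentMeterMax ρ η f x₀ s hmax R Hs B j := by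
  apply Real.sSup_nonneg
  rintro _ ⟨u, -, rfl⟩
  exact tentAt_nonneg _ _ _ _

/-- (K) the set of lowest states of a level is finite (§H.7 `stColP_level_finite`). -/
theorem isLowest_finite {η : ℝ} {f : ℂ → ℂ} {x₀ s hmax R Hs : ℝ} {B : ℕ} (hE : EngineHyps5 2 η f x₀ s hmax R Hs B) (j : ℕ) :
    {u : ℂ | IsLowest StCol' η f x₀ s hmax R Hs B j u}.Finite :=
  (stColP_level_finite hE j).subset fun _ hu => hu.1

/-- (K) on a non-empty level the MAX is ATTAINED at some lowest state. -/
theorem tentMeterMax_attained {ρ η : ℝ} {f : ℂ → ℂ} {x₀ s hmax R Hs : ℝ} {B : ℕ} (hE : EngineHyps5 2 η f x₀ s hmax R Hs B) {j : ℕ}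
    {v : ℂ} (hv : IsLowest StCol' η f x₀ s hmax R Hs B j v) :
    ∃ u : ℂ, IsLowest StCol' η f x₀ s hmax R Hs B j u ∧ tentMeterMax ρ η f x₀ s hmax R Hs B j = tentAt ρ f j u := by
  have hfin := (isLowest_finite hE j).image (tentAt ρ f j)
  have hne : (tentAt ρ f j '' {u : ℂ | IsLowest StCol' η f x₀ s hmax R Hs B j u}).Nonempty := ⟨_, ⟨v, hv, rfl⟩⟩
  obtain ⟨u, hu, heq⟩ := (Set.mem_image _ _ _).mp (Set.Nonempty.csSup_mem hne hfin)
  exact ⟨u, hu, heq.symm⟩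

/-- (K, Schwarz reflection) an entire function real on the real axis vanishes at `ū` whenever it vanishes at `u`
(identity principle: `z ↦ conj (f (conj z))` is entire and agrees with `f` on `ℝ`). -/
theorem conj_zero_of_real_entire {f : ℂ → ℂ} (hd : Differentiable ℂ f) (hreal : ∀ x : ℝ, (f (x : ℂ)).im = 0)
    {z : ℂ} (hz : f z = 0) : f ((starRingEnd ℂ) z) = 0 := by
  let g : ℂ → ℂ := fun w => (starRingEnd ℂ) (f ((starRingEnd ℂ) w))
  have hgd : Differentiable ℂ g := by
    intro w
    have h1 := (hd ((starRingEnd ℂ) w)).conj_conj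
    rw [Complex.conj_conj] at h1
    exact h1
  have hfa : AnalyticOnNhd ℂ f Set.univ := fun w _ => hd.analyticAt w
  have hga : AnalyticOnNhd ℂ g Set.univ := fun w _ => hgd.analyticAt w
  have hagree : ∀ x : ℝ, f (x : ℂ) = g (x : ℂ) := by
    intro x
    show f (x : ℂ) = (starRingEnd ℂ) (f ((starRingEnd ℂ) (x : ℂ)))
    rw [Complex.conj_ofReal]
    exact (Complex.conj_eq_iff_im.mpr (hreal x)).symm
  have htend : Tendsto (fun x : ℝ => (x : ℂ)) (𝓝[≠] 0) (𝓝[≠] 0) := by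
    apply tendsto_nhdsWithin_of_tendsto_nhds_of_eventually_within
    · exact (Complex.continuous_ofReal.tendsto' 0 0 (by simp)).mono_left nhdsWithin_le_nhds
    · exact eventually_nhdsWithin_of_forall fun x hx => by simpa using hx
  have hfreq : ∃ᶠ w in 𝓝[≠] (0 : ℂ), f w = g w :=
    htend.frequently (Filter.Eventually.frequently (Filter.Eventually.of_forall hagree))
  have hfg : f = g := AnalyticOnNhd.eq_of_frequently_eq hfa hga hfreq
  have hgz : g ((starRingEnd ℂ) z) = 0 := by
    show (starRingEnd ℂ) (f ((starRingEnd ℂ) ((starRingEnd ℂ) z))) = 0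
    rw [Complex.conj_conj, hz, map_zero]
  rw [hfg]; exact hgz

/-- (K) a zero of a non-zero entire function has POSITIVE (finite) order: its multiplicity weight is `≥ 1`. -/
theorem one_le_orderToNat_of_zero {g : ℂ → ℂ} (hg : Differentiable ℂ g) (hne : g ≠ 0) {w : ℂ} (hw : g w = 0) :
    (1 : ℝ) ≤ ((analyticOrderAt g w).toNat : ℝ) := by
  have hga : AnalyticAt ℂ g w := hg.analyticAt w
  have hntop : analyticOrderAt g w ≠ ⊤ := by
    intro htop
    have huniv : AnalyticOnNhd ℂ g Set.univ := fun z _ => hg.analyticAt z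
    have hall := huniv.eqOn_zero_of_preconnected_of_eventuallyEq_zero isPreconnected_univ (Set.mem_univ w)
      (analyticOrderAt_eq_top.mp htop)
    exact hne (funext fun z => hall (Set.mem_univ z))
  have hne0 : analyticOrderAt g w ≠ 0 := by
    rw [Ne, hga.analyticOrderAt_eq_zero]; exact fun h => h hw
  obtain ⟨n, hn⟩ := ENat.ne_top_iff_exists.mp hntop
  rw [← hn] at hne0 ⊢
  have hn0 : n ≠ 0 := fun h0 => hne0 (by simp [h0])
  have h1 : 1 ≤ n := Nat.one_le_iff_ne_zero.mpr hn0
  simp only [ENat.toNat_coe]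
  exact_mod_cast h1

/-- (K) all zeros in the band `|Im| ≤ Hs` ⇒ the zero set of any vertical strip is finite. -/
theorem strip_zeros_finite {f : ℂ → ℂ} (hd : Differentiable ℂ f) (hne : f ≠ 0) {Hs : ℝ} (hband : ∀ w : ℂ, f w = 0 → |w.im| ≤ Hs)
    (c r : ℝ) : {z : ℂ | f z = 0 ∧ |z.re - c| ≤ r}.Finite := by
  refine (finite_zeros_closedBall_of_entire hd hne (c : ℂ) (|r| + Hs)).subset ?_
  intro z hz
  obtain ⟨hz0, hzre⟩ := hz
  refine ⟨?_, hz0⟩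
  rw [Metric.mem_closedBall, dist_eq_norm]
  have h1 : ‖z - (c : ℂ)‖ ≤ |(z - (c : ℂ)).re| + |(z - (c : ℂ)).im| := Complex.norm_le_abs_re_add_abs_im _
  have h2 : (z - (c : ℂ)).re = z.re - c := by simp
  have h3 : (z - (c : ℂ)).im = z.im := by simp
  rw [h2, h3] at h1
  have h4 := hband z hz0
  have h5 : |z.re - c| ≤ |r| := hzre.trans (le_abs_self r)
  linarith

/-- ★ (K) **PAIR BOOKKEEPING**: tent strip inside a bigger strip containing `Re u` ⇒ `tentCount + 2 ≤ stripCount`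
(the pair `{u, ū}` sits in the big strip with positive orders and is excluded from the tent; weights are non-negative; both zero sets finite). -/
theorem tentCount_add_two_le_stripCount {f : ℂ → ℂ} (hd : Differentiable ℂ f) (hne : f ≠ 0)
    (hreal : ∀ x : ℝ, (f (x : ℂ)).im = 0) {Hs : ℝ} (hband : ∀ w : ℂ, f w = 0 → |w.im| ≤ Hs)
    {u : ℂ} (hu0 : f u = 0) (huim : 0 < u.im) {c r t : ℝ}
    (ht : ∀ z : ℂ, |z.re - u.re| ≤ t → |z.re - c| ≤ r) (huc : |u.re - c| ≤ r) :
    tentCount f u.re t u + 2 ≤ stripCount f c r := by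
  classical
  have hSfin : {z : ℂ | f z = 0 ∧ |z.re - c| ≤ r}.Finite := strip_zeros_finite hd hne hband c r
  have hTS : {z : ℂ | f z = 0 ∧ |z.re - u.re| ≤ t ∧ z ≠ u ∧ z ≠ (starRingEnd ℂ) u} ⊆ {z : ℂ | f z = 0 ∧ |z.re - c| ≤ r} :=
    fun z hz => ⟨hz.1, ht z hz.2.1⟩
  have hTfin : {z : ℂ | f z = 0 ∧ |z.re - u.re| ≤ t ∧ z ≠ u ∧ z ≠ (starRingEnd ℂ) u}.Finite := hSfin.subset hTS
  have eS : stripCount f c r = ∑ z ∈ hSfin.toFinset, ((analyticOrderAt f z).toNat : ℝ) := by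
    unfold stripCount
    exact finsum_mem_eq_finite_toFinset_sum _ hSfin
  have eT : tentCount f u.re t u = ∑ z ∈ hTfin.toFinset, ((analyticOrderAt f z).toNat : ℝ) := by
    unfold tentCount
    exact finsum_mem_eq_finite_toFinset_sum _ hTfin
  -- the pair
  have hub0 : f ((starRingEnd ℂ) u) = 0 := conj_zero_of_real_entire hd hreal hu0
  have hne_pair : u ≠ (starRingEnd ℂ) u := by
    intro h
    have him := congrArg Complex.im h
    rw [Complex.conj_im] at him
    linarith
  have huS : u ∈ hSfin.toFinset := by
    rw [Set.Finite.mem_toFinset]; exact ⟨hu0, huc⟩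
  have hubS : (starRingEnd ℂ) u ∈ hSfin.toFinset := by
    rw [Set.Finite.mem_toFinset]
    refine ⟨hub0, ?_⟩
    rw [Complex.conj_re]; exact huc
  have huT : u ∉ hTfin.toFinset := by
    rw [Set.Finite.mem_toFinset]; exact fun h => h.2.2.1 rfl
  have hubT : (starRingEnd ℂ) u ∉ hTfin.toFinset := by
    rw [Set.Finite.mem_toFinset]; exact fun h => h.2.2.2 rfl
  have huT' : u ∉ insert ((starRingEnd ℂ) u) hTfin.toFinset := by
    rw [Finset.mem_insert, not_or]; exact ⟨hne_pair, huT⟩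
  have hsub : insert u (insert ((starRingEnd ℂ) u) hTfin.toFinset) ⊆ hSfin.toFinset := by
    intro z hz
    rcases Finset.mem_insert.mp hz with rfl | hz
    · exact huS
    rcases Finset.mem_insert.mp hz with rfl | hz
    · exact hubS
    · rw [Set.Finite.mem_toFinset] at hz ⊢; exact hTS hz
  have hle := Finset.sum_le_sum_of_subset_of_nonneg hsub
    (fun z _ _ => (Nat.cast_nonneg _ : (0 : ℝ) ≤ ((analyticOrderAt f z).toNat : ℝ)))
  rw [Finset.sum_insert huT', Finset.sum_insert hubT] at hle
  have hwu : (1 : ℝ) ≤ ((analyticOrderAt f u).toNat : ℝ) := one_le_orderToNat_of_zero hd hne hu0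
  have hwub : (1 : ℝ) ≤ ((analyticOrderAt f ((starRingEnd ℂ) u)).toNat : ℝ) := one_le_orderToNat_of_zero hd hne hub0
  rw [eS, eT]
  linarith

/-- (K) the near-column class `|Re u − x₀| ≤ s` lies inside the anchor class 𝒜. -/
theorem anchor_of_nearColumn {δ h s : ℝ} (hs : 0 < s) (hδ : |δ| ≤ s) : |δ| ≤ s + (h - s) ^ 2 / (2 * s) := by
  have : 0 ≤ (h - s) ^ 2 / (2 * s) := div_nonneg (sq_nonneg _) (by linarith)
  linarith

/-- ★★ (K) **THE SEALED INIT, per state**: a level-0 `StCol'` state `u` in the ANCHOR CLASS 𝒜 has tent reading `T_0(1)(u) ≤ (Hs/s)² + B + 1`.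
Inputs from `EngineHyps5` only: entire, real on `ℝ`, the zero band `|Im| ≤ Hs`, `0 < s`, `2s ≤ hmax`, `3·hmax < R`, `2·Hs ≤ R`, `ColumnBudgetMult`. -/
theorem tentAt_le_purse_of_anchor {η : ℝ} {f : ℂ → ℂ} {x₀ s hmax R Hs : ℝ} {B : ℕ} (hE : EngineHyps5 2 η f x₀ s hmax R Hs B)
    {u : ℂ} (hu : StCol' η f x₀ s hmax R Hs B 0 u) (hanc : |u.re - x₀| ≤ s + (u.im - s) ^ 2 / (2 * s)) :
    tentAt 1 f 0 u ≤ (Hs / s) ^ 2 + B + 1 := by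
  obtain ⟨hdiff, hreal, -, hs, hCs, hChm, h3hm, -, hband, hCHs, -, hCB, -⟩ := hE
  obtain ⟨hf0, hu0, huim, hure, huHs⟩ := hu
  simp only [iteratedDeriv_zero] at hf0 hu0
  have hure' : |u.re - x₀| ≤ R / 2 := by simpa using hure
  simp only [tentAt, iteratedDeriv_zero, one_mul]
  -- the budget radius
  set r : ℝ := max s (u.im + |u.re - x₀|) with hr
  have hsr : s ≤ r := le_max_left _ _
  have hrR : r ≤ R := by
    apply max_le
    · nlinarith
    · linarith
  have habs0 : 0 ≤ |u.re - x₀| := abs_nonneg _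
  have hT : tentCount f u.re u.im u + 2 ≤ stripCount f x₀ r := by
    refine tentCount_add_two_le_stripCount hdiff hf0 hreal hband hu0 huim ?_ ?_
    · intro z hz
      have := abs_sub_le z.re u.re x₀
      have h2 : u.im + |u.re - x₀| ≤ r := le_max_right _ _
      linarith
    · have h2 : u.im + |u.re - x₀| ≤ r := le_max_right _ _
      linarith
  have hbud : stripCount f x₀ r - 2 * r / s ≤ B := hCB r hsr hrR
  -- 2r/s ≤ (Hs/s)² + 3
  have hkey : 2 * r / s ≤ (Hs / s) ^ 2 + 3 := by
    have hs0 : s ≠ 0 := hs.ne'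
    rcases le_total (u.im + |u.re - x₀|) s with hcase | hcase
    · have hmax : r = s := by rw [hr]; exact max_eq_left hcase
      rw [hmax]
      have : 2 * s / s = 2 := by field_simp
      rw [this]
      nlinarith [sq_nonneg (Hs / s)]
    · have hmax : r = u.im + |u.re - x₀| := by rw [hr]; exact max_eq_right hcase
      rw [hmax]
      -- anchor: 2|δ|s ≤ 2s² + (Im u − s)²
      have h2s : 0 < 2 * s := by linarith
      have hanc' : |u.re - x₀| * (2 * s) ≤ 2 * s ^ 2 + (u.im - s) ^ 2 := by
        have h1 := mul_le_mul_of_nonneg_right hanc h2s.le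
        have e : (s + (u.im - s) ^ 2 / (2 * s)) * (2 * s) = 2 * s ^ 2 + (u.im - s) ^ 2 := by
          field_simp
        rw [e] at h1; exact h1
      have hnum : 2 * (u.im + |u.re - x₀|) * s ≤ Hs ^ 2 + 3 * s ^ 2 := by
        have hsq : u.im ^ 2 ≤ Hs ^ 2 := by nlinarith
        nlinarith
      rw [div_le_iff₀ hs]
      have e2 : ((Hs / s) ^ 2 + 3) * s = (Hs ^ 2 + 3 * s ^ 2) / s := by
        field_simp
      rw [e2, le_div_iff₀ hs]
      linarith
  linarith

/-- **`AnchorSig`** — the typed NAME of the anchor hypothesis (director (a)): every lowest level-0 `StCol'` state lies in 𝒜.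
NOT claimed as a closed Prop (declared false in-model off 𝒜: FL2 x₀-booking); it is what the sealed INIT is K-conditional on. -/
def AnchorSig : Prop :=
  ∀ (η : ℝ) (f : ℂ → ℂ) (x₀ s hmax R Hs : ℝ) (B : ℕ), EngineHyps5 2 η f x₀ s hmax R Hs B →
    ∀ u : ℂ, IsLowest StCol' η f x₀ s hmax R Hs B 0 u → |u.re - x₀| ≤ s + (u.im - s) ^ 2 / (2 * s)

/-- ★★ (K) **the (β2′) INIT of the sealed meter, per datum, on the anchor class**: `T^max_0(1) ≤ (Hs/s)² + B + 1`. -/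
theorem tentMeterMax_init_of_anchor {η : ℝ} {f : ℂ → ℂ} {x₀ s hmax R Hs : ℝ} {B : ℕ} (hE : EngineHyps5 2 η f x₀ s hmax R Hs B)
    (hanc : ∀ u : ℂ, IsLowest StCol' η f x₀ s hmax R Hs B 0 u → |u.re - x₀| ≤ s + (u.im - s) ^ 2 / (2 * s)) :
    tentMeterMax 1 η f x₀ s hmax R Hs B 0 ≤ (Hs / s) ^ 2 + B + 1 := by
  by_cases hne : ∃ v : ℂ, IsLowest StCol' η f x₀ s hmax R Hs B 0 v
  · obtain ⟨v, hv⟩ := hne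
    obtain ⟨u, hu, heq⟩ := tentMeterMax_attained (ρ := 1) hE hv
    rw [heq]
    exact tentAt_le_purse_of_anchor hE hu.1 (hanc u hu)
  · have hempty : {u : ℂ | IsLowest StCol' η f x₀ s hmax R Hs B 0 u} = ∅ := by
      ext u
      simp only [Set.mem_setOf_eq, Set.mem_empty_iff_false, iff_false]
      exact fun hu => hne ⟨u, hu⟩
    show sSup (tentAt 1 f 0 '' {u : ℂ | IsLowest StCol' η f x₀ s hmax R Hs B 0 u}) ≤ (Hs / s) ^ 2 + B + 1
    rw [hempty, Set.image_empty, Real.sSup_empty]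
    positivity

/-- ★★ (K) `AnchorSig → MonovariantInit (tentMeterMax 1)` — the `k = 0` instance of the sealed prefix node, K modulo the anchor hypothesis. -/
theorem monovariantInit_tentMeterMax_of_anchor (hA : AnchorSig) : MonovariantInit (tentMeterMax 1) :=
  fun η f x₀ s hmax R Hs B hE => tentMeterMax_init_of_anchor hE (hA η f x₀ s hmax R Hs B hE)

/-- (K) the ON-COLUMN sub-case of the anchor hypothesis, stated per datum: `|Re u − x₀| ≤ s` for every lowest level-0 state suffices. -/
theorem tentMeterMax_init_of_nearColumn {η : ℝ} {f : ℂ → ℂ} {x₀ s hmax R Hs : ℝ} {B : ℕ} (hE : EngineHyps5 2 η f x₀ s hmax R Hs B)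
    (hnear : ∀ u : ℂ, IsLowest StCol' η f x₀ s hmax R Hs B 0 u → |u.re - x₀| ≤ s) :
    tentMeterMax 1 η f x₀ s hmax R Hs B 0 ≤ (Hs / s) ^ 2 + B + 1 :=
  tentMeterMax_init_of_anchor hE fun u hu => anchor_of_nearColumn (h := u.im) hE.2.2.2.1 (hnear u hu)

end RhIdea6.G21.W07C13.TentMax
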